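import Mathlib.Logic.Equiv.Fin.Rotate
import Literature.Computability.AlgebraicComplexity.StandardFamilies
import HarnessLib

/-!
# `IMM` is the closed-walk polynomial (Kumar–Saraf 2017, §8.1, §8.3: "each monomial … corresponds
to a path from the leftmost layer to the rightmost layer")

Topic `Literature/Computability/AlgebraicComplexity`; infrastructure for the printed proof of
`kumarSaraf2017_imm_homDepthFour` (`HomogeneousDepthFour.lean`), the combinatorial handle on the
polynomial `IMM`: the tree's `immPoly N d k = tr (X⁽⁰⁾ ⋯ X⁽ᵈ⁻¹⁾)` (`StandardFamilies.lean`) is the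
sum, over all closed walks `v : Fin d → Fin N` in the layered graph (vertex `v t` before the
matrix `X⁽ᵗ⁾`, returning to `v 0` after `X⁽ᵈ⁻¹⁾`), of the multilinear monomials
`∏_t x⁽ᵗ⁾_{v t, v (t+1)}`, each with coefficient `1`:

* `layerMatX`, `prefixProdX` — the layer matrices `(x⁽ᵗ⁾_{ij})` and their prefix products;
  `immMatrix_eq_prefixProdX`;
* `prefixProdX_apply` — the `(i, j)` entry of `X⁽⁰⁾ ⋯ X⁽ᵗ⁻¹⁾` is the sum over the walks of length
  `t` from `i` to `j` of their monomials (walks encoded, after Limaye–Srinivasan–Tavenas'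
  prefix device of `AutomatonIMM.lean`, as maps `Fin (d+1) → Fin N` constant `= i` beyond `t`);
* `closedWalkExp v` — the exponent vector of the closed walk `v`, `closedWalkExp_injective`;
* **`immPoly_eq_sum_closedWalks`** — `IMM_{N,d} = ∑_v x^{closedWalkExp v}` (`0 < d`);
  `coeff_immPoly_closedWalkExp` (`= 1`), `coeff_immPoly_eq_zero` (off the walks),
  `mem_support_immPoly`, `le_one_of_mem_support_immPoly` (multilinearity: `≤ 1` in each variable).

Kumar–Saraf, §8.3: "one can view any `IMM^*` as an `n`-tuple of bipartite graphs … each monomial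
in `S(IMM)` corresponds to a path from the leftmost layer to the rightmost layer"; this file is
that dictionary for the tree's trace form. Everything is proved; folklore.

## References

* M. Kumar, S. Saraf, *On the power of homogeneous depth 4 arithmetic circuits*, SIAM J. Comput.
  46 (2017) 336–387 (arXiv:1404.1950): §8.1, §8.3.
* N. Limaye, S. Srinivasan, S. Tavenas, J. ACM 72 (2025), Art. 26, §2.2 (`IMM` as a sum over
  paths).
-/

noncomputable section

open MvPolynomial

namespace Literature.Computability.AlgebraicComplexity

namespace IMMWalk

universe u

variable (N d : ℕ) (K : Type u) [CommSemiring K]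

/-! ### Layer matrices and prefix products -/

/-- The layer matrix `(x⁽ᵗ⁾_{ij})_{ij}` of generic variables, padded by `1` beyond `d`.
[cite: KumarSaraf2017, §8.1] -/
def layerMatX (t : ℕ) : Matrix (Fin N) (Fin N) (MvPolynomial (Fin d × Fin N × Fin N) K) :=
  if h : t < d then Matrix.of fun i j => X (⟨t, h⟩, i, j) else 1

/-- The prefix product `X⁽⁰⁾ ⋯ X⁽ᵗ⁻¹⁾`. [cite: KumarSaraf2017, §8.1] -/
def prefixProdX (t : ℕ) : Matrix (Fin N) (Fin N) (MvPolynomial (Fin d × Fin N × Fin N) K) :=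
  ((List.range t).map (layerMatX N d K)).prod

/-- The generic matrix product of `StandardFamilies.immMatrix` is the full prefix product.
[cite: KumarSaraf2017, §8.1] -/
theorem immMatrix_eq_prefixProdX : immMatrix (Fin N) d K = prefixProdX N d K d := by
  unfold immMatrix prefixProdX
  congr 1
  apply List.ext_getElem
  · simp
  · intro i h₁ h₂
    rw [List.getElem_map, List.getElem_map, List.getElem_finRange, List.getElem_range, layerMatX,
      dif_pos (by simpa using h₁)]
    ext a b
    simp [Matrix.map_apply, Matrix.mvPolynomialX_apply]

/-- One more layer: `X⁽⁰⁾ ⋯ X⁽ᵗ⁾ = (X⁽⁰⁾ ⋯ X⁽ᵗ⁻¹⁾) · X⁽ᵗ⁾`. [folklore] -/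
theorem prefixProdX_succ (t : ℕ) :
    prefixProdX N d K (t + 1) = prefixProdX N d K t * layerMatX N d K t := by
  unfold prefixProdX
  rw [List.range_succ, List.map_append, List.prod_append, List.map_singleton, List.prod_singleton]

/-! ### Walks -/

variable {N d K}

/-- The variable read by the walk `w` at the matrix `X⁽ˢ⁾`: `x⁽ˢ⁾_{w s, w (s+1)}`.
[cite: KumarSaraf2017, §8.3] -/
def stepVar (w : Fin (d + 1) → Fin N) (s : Fin d) : Fin d × Fin N × Fin N :=
  (s, w s.castSucc, w s.succ)

/-- The monomial of the first `t` steps of the walk `w`. [cite: KumarSaraf2017, §8.3] -/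
def prefixMono (t : ℕ) (w : Fin (d + 1) → Fin N) : MvPolynomial (Fin d × Fin N × Fin N) K :=
  ∏ s ∈ Finset.univ.filter (fun s : Fin d => (s : ℕ) < t), X (stepVar w s)

/-- The walks of length `t` from `i`, encoded as vertex sequences of full length `d + 1` that are
constant `= i` beyond position `t` (the prefix device). [folklore] -/
def prefixWalks (t : ℕ) (i : Fin N) : Finset (Fin (d + 1) → Fin N) :=
  Finset.univ.filter fun w => w ⟨0, Nat.succ_pos d⟩ = i ∧ ∀ s : Fin (d + 1), t < (s : ℕ) → w s = i

variable (K) in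
/-- **The entries of the prefix products are sums over walks**: for `t ≤ d`,
`(X⁽⁰⁾ ⋯ X⁽ᵗ⁻¹⁾)_{ij} = ∑_{w : i ⟶ j, |w| = t} ∏_{s<t} x⁽ˢ⁾_{w s, w (s+1)}`.
[cite: KumarSaraf2017, §8.3] -/
theorem prefixProdX_apply {t : ℕ} (ht : t ≤ d) (i j : Fin N) :
    prefixProdX N d K t i j =
      ∑ w ∈ (prefixWalks t i).filter (fun w => w ⟨t, by omega⟩ = j), prefixMono (K := K) t w := by
  induction t generalizing j with
  | zero =>
    -- the identity matrix and the constant walk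
    have hpw : (prefixWalks (d := d) 0 i).filter (fun w => w ⟨0, by omega⟩ = j) =
        if i = j then {fun _ => i} else ∅ := by
      ext w
      simp only [prefixWalks, Finset.mem_filter, Finset.mem_univ, true_and]
      constructor
      · rintro ⟨⟨h0, hall⟩, hj⟩
        have hw : w = fun _ => i := by
          funext s
          by_cases hs : (s : ℕ) = 0
          · have : s = ⟨0, Nat.succ_pos d⟩ := Fin.ext hs
            rw [this, h0]
          · exact hall s (Nat.pos_of_ne_zero hs)
        have hij : i = j := h0.symm.trans hj
        subst hw
        rw [if_pos hij]
        exact Finset.mem_singleton_self _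
      · intro h
        split_ifs at h with hij
        · rw [Finset.mem_singleton] at h
          subst h
          exact ⟨⟨rfl, fun _ _ => rfl⟩, hij⟩
        · exact absurd h (Finset.notMem_empty _)
    rw [hpw]
    unfold prefixProdX
    simp only [List.range_zero, List.map_nil, List.prod_nil]
    rw [Matrix.one_apply]
    split_ifs with hij
    · rw [Finset.sum_singleton]
      unfold prefixMono
      rw [Finset.filter_false_of_mem (fun s _ => Nat.not_lt_zero _), Finset.prod_empty]
    · rw [Finset.sum_empty]
  | succ t ih =>
    have ht' : t ≤ d := Nat.le_of_succ_le ht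
    have htd : t < d := ht
    rw [prefixProdX_succ, Matrix.mul_apply]
    -- expand the entries of the shorter product
    simp_rw [ih ht']
    rw [layerMatX, dif_pos htd]
    simp only [Matrix.of_apply, Finset.sum_mul]
    -- LHS: `∑_l ∑_{w : i ⟶ l} mono_t(w) x_{l j}`; regroup as a sum over `w ∈ prefixWalks t i`
    have hfib : ∑ l : Fin N, ∑ w ∈ (prefixWalks t i).filter (fun w => w ⟨t, by omega⟩ = l),
        prefixMono (K := K) t w * X (⟨t, htd⟩, l, j) =
        ∑ w ∈ prefixWalks t i, prefixMono (K := K) t w * X (⟨t, htd⟩, w ⟨t, by omega⟩, j) := by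
      rw [← Finset.sum_fiberwise_of_maps_to (s := prefixWalks t i) (t := Finset.univ)
        (g := fun w => w ⟨t, by omega⟩) (fun _ _ => Finset.mem_univ _)]
      refine Finset.sum_congr rfl fun l _ => Finset.sum_congr rfl fun w hw => ?_
      rw [(Finset.mem_filter.1 hw).2]
    rw [hfib]
    -- RHS: walks of length `t + 1` ending at `j` are `update w (t+1) j`, `w` of length `t`
    have hinj : Set.InjOn (fun w : Fin (d + 1) → Fin N => Function.update w ⟨t + 1, by omega⟩ j)
        (↑(prefixWalks (d := d) t i) : Set (Fin (d + 1) → Fin N)) := by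
      intro w₁ h₁ w₂ h₂ h
      rw [Finset.mem_coe, prefixWalks, Finset.mem_filter] at h₁ h₂
      funext s
      by_cases hs : s = ⟨t + 1, by omega⟩
      · rw [hs, h₁.2.2 _ (by simp), h₂.2.2 _ (by simp)]
      · have := congrFun h s
        dsimp only at this
        rwa [Function.update_of_ne hs, Function.update_of_ne hs] at this
    have himage : (prefixWalks (d := d) (t + 1) i).filter (fun w => w ⟨t + 1, by omega⟩ = j) =
        (prefixWalks (d := d) t i).image fun w => Function.update w ⟨t + 1, by omega⟩ j := by
      ext w
      simp only [prefixWalks, Finset.mem_filter, Finset.mem_univ, true_and, Finset.mem_image]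
      constructor
      · rintro ⟨⟨h0, hall⟩, hj⟩
        refine ⟨Function.update w ⟨t + 1, by omega⟩ i, ⟨?_, fun s hs => ?_⟩, ?_⟩
        · rw [Function.update_of_ne (by simp [Fin.ext_iff])]; exact h0
        · by_cases hs' : s = ⟨t + 1, by omega⟩
          · rw [hs', Function.update_self]
          · rw [Function.update_of_ne hs']
            refine hall s ?_
            have : (s : ℕ) ≠ t + 1 := fun h => hs' (Fin.ext h)
            omega
        · rw [Function.update_idem, ← hj, Function.update_eq_self]
      · rintro ⟨w', ⟨h0, hall⟩, rfl⟩
        refine ⟨⟨?_, fun s hs => ?_⟩, Function.update_self _ _ _⟩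
        · rw [Function.update_of_ne (by simp [Fin.ext_iff])]; exact h0
        · rw [Function.update_of_ne (fun h => by subst h; simp at hs)]
          exact hall s (by omega)
    rw [himage, Finset.sum_image hinj]
    refine Finset.sum_congr rfl fun w hw => ?_
    rw [prefixWalks, Finset.mem_filter] at hw
    -- `mono_{t+1}(update w (t+1) j) = mono_t(w) · x⁽ᵗ⁾_{w t, j}`
    unfold prefixMono
    have hsplit : Finset.univ.filter (fun s : Fin d => (s : ℕ) < t + 1) =
        insert ⟨t, htd⟩ (Finset.univ.filter fun s : Fin d => (s : ℕ) < t) := by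
      ext s
      simp only [Finset.mem_filter, Finset.mem_univ, true_and, Finset.mem_insert, Fin.ext_iff]
      omega
    have hprod : ∏ s ∈ Finset.univ.filter (fun s : Fin d => (s : ℕ) < t),
        (X (stepVar (Function.update w ⟨t + 1, by omega⟩ j) s) :
          MvPolynomial (Fin d × Fin N × Fin N) K) =
        ∏ s ∈ Finset.univ.filter (fun s : Fin d => (s : ℕ) < t), X (stepVar w s) := by
      refine Finset.prod_congr rfl fun s hs => ?_
      rw [Finset.mem_filter] at hs
      unfold stepVar
      rw [Function.update_of_ne (fun h => ?_), Function.update_of_ne (fun h => ?_)]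
      · rw [Fin.ext_iff] at h
        simp at h
        omega
      · rw [Fin.ext_iff] at h
        simp at h
        omega
    have hlast : stepVar (Function.update w ⟨t + 1, by omega⟩ j) ⟨t, htd⟩ =
        (⟨t, htd⟩, w ⟨t, by omega⟩, j) := by
      unfold stepVar
      have e1 : (⟨t, htd⟩ : Fin d).castSucc = ⟨t, by omega⟩ := rfl
      have e2 : (⟨t, htd⟩ : Fin d).succ = ⟨t + 1, by omega⟩ := rfl
      rw [e1, e2, Function.update_self, Function.update_of_ne (fun h => ?_)]
      rw [Fin.ext_iff] at h
      simp at h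
    rw [hsplit, Finset.prod_insert (by simp), hlast, hprod, mul_comm]

/-! ### Closed walks and the expansion of `IMM` -/

/-- The exponent vector of the closed walk `v` (vertex `v t` before `X⁽ᵗ⁾`, back to `v 0` at the
end): `∑_t e_{(t, v t, v (t+1 mod d))}`. [cite: KumarSaraf2017, §8.3] -/
def closedWalkExp (v : Fin d → Fin N) : (Fin d × Fin N × Fin N) →₀ ℕ :=
  ∑ t : Fin d, Finsupp.single (t, v t, v (finRotate d t)) 1

/-- The variable of layer `t` read by the closed walk `v`. [cite: KumarSaraf2017, §8.3] -/
theorem closedWalkExp_apply (v : Fin d → Fin N) (x : Fin d × Fin N × Fin N) :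
    closedWalkExp v x = if x = (x.1, v x.1, v (finRotate d x.1)) then 1 else 0 := by
  classical
  unfold closedWalkExp
  rw [Finsupp.finsetSum_apply]
  simp only [Finsupp.single_apply]
  rw [Finset.sum_eq_single x.1]
  · by_cases h : x = (x.1, v x.1, v (finRotate d x.1))
    · rw [if_pos h, if_pos h.symm]
    · rw [if_neg h, if_neg (Ne.symm h)]
  · intro t _ ht
    rw [if_neg]
    rintro rfl
    exact ht rfl
  · intro h; exact absurd (Finset.mem_univ _) h

/-- Closed-walk exponent vectors are multilinear. [cite: KumarSaraf2017, §8.3] -/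
theorem closedWalkExp_le_one (v : Fin d → Fin N) (x : Fin d × Fin N × Fin N) :
    closedWalkExp v x ≤ 1 := by
  rw [closedWalkExp_apply]
  split_ifs <;> simp

/-- The closed walk is determined by its exponent vector. [cite: KumarSaraf2017, §8.3] -/
theorem closedWalkExp_injective :
    Function.Injective (closedWalkExp (N := N) (d := d)) := by
  intro v w h
  funext t
  have h1 := congrFun (congrArg DFunLike.coe h) (t, v t, v (finRotate d t))
  rw [closedWalkExp_apply, closedWalkExp_apply, if_pos rfl] at h1
  by_cases h2 : ((t, v t, v (finRotate d t)) : Fin d × Fin N × Fin N) = (t, w t, w (finRotate d t))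
  · exact (Prod.ext_iff.1 (Prod.ext_iff.1 h2).2).1
  · rw [if_neg h2] at h1
    exact absurd h1 one_ne_zero

/-- The monomial of the closed walk `v` as a product of variables. [folklore] -/
theorem prod_X_closedWalk (v : Fin d → Fin N) :
    (∏ t : Fin d, X (t, v t, v (finRotate d t)) : MvPolynomial (Fin d × Fin N × Fin N) K) =
      monomial (closedWalkExp v) 1 := by
  unfold closedWalkExp
  rw [monomial_sum_one]
  rfl

/-- The successor-mod-`d` map on `Fin d`, on values. [folklore] -/
theorem val_finRotate (hd : 0 < d) (t : Fin d) :
    ((finRotate d t : Fin d) : ℕ) = if (t : ℕ) + 1 < d then (t : ℕ) + 1 else 0 := by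
  obtain ⟨d', rfl⟩ := Nat.exists_eq_succ_of_ne_zero hd.ne'
  rw [coe_finRotate]
  by_cases h : t = Fin.last d'
  · subst h
    simp
  · rw [if_neg h, if_pos]
    have := Fin.val_lt_last h
    omega

/-- The steps of the closed walk `v`, read off the vertex sequence `snoc v (v 0)`. [folklore] -/
theorem stepVar_snoc (hd : 0 < d) (v : Fin d → Fin N) (t : Fin d) :
    stepVar (Fin.snoc v (v ⟨0, hd⟩) : Fin (d + 1) → Fin N) t = (t, v t, v (finRotate d t)) := by
  unfold stepVar
  refine Prod.ext rfl (Prod.ext ?_ ?_)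
  · change (Fin.snoc v (v ⟨0, hd⟩) : Fin (d + 1) → Fin N) t.castSucc = v t
    exact Fin.snoc_castSucc (α := fun _ => Fin N) _ _ _
  change (Fin.snoc v (v ⟨0, hd⟩) : Fin (d + 1) → Fin N) t.succ = v (finRotate d t)
  have hval := val_finRotate hd t
  by_cases ht : (t : ℕ) + 1 < d
  · rw [if_pos ht] at hval
    have h1 : finRotate d t = ⟨(t : ℕ) + 1, ht⟩ := Fin.ext hval
    have h2 : t.succ = (⟨(t : ℕ) + 1, ht⟩ : Fin d).castSucc := Fin.ext rfl
    rw [h1, h2, Fin.snoc_castSucc]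
  · rw [if_neg ht] at hval
    have h1 : finRotate d t = ⟨0, hd⟩ := Fin.ext hval
    have h2 : t.succ = Fin.last d := Fin.ext (by simp; omega)
    rw [h1, h2, Fin.snoc_last]

variable (N d K) in
/-- **`IMM` is the closed-walk polynomial**: for `d ≥ 1`,
`IMM_{N,d} = tr(X⁽⁰⁾ ⋯ X⁽ᵈ⁻¹⁾) = ∑_{v : Fin d → Fin N} ∏_t x⁽ᵗ⁾_{v t, v (t+1 mod d)}`
(expand the trace of the product; a closed walk is a vertex sequence `w` of length `d` with
`w d = w 0`). [cite: KumarSaraf2017, §8.3] -/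
theorem immPoly_eq_sum_closedWalks (hd : 0 < d) :
    immPoly N d K = ∑ v : Fin d → Fin N, monomial (closedWalkExp v) 1 := by
  classical
  unfold immPoly
  rw [immMatrix_eq_prefixProdX, Matrix.trace]
  simp only [Matrix.diag_apply]
  simp_rw [prefixProdX_apply K le_rfl]
  -- closed walks `w` (`w 0 = i = w d`) versus `v = w ∘ castSucc`
  symm
  rw [← Finset.sum_fiberwise_of_maps_to (g := fun v : Fin d → Fin N => v ⟨0, hd⟩)
    (t := Finset.univ) (fun _ _ => Finset.mem_univ _)]
  refine Finset.sum_congr rfl fun i _ => ?_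
  -- bijection `v ↦ snoc v (v 0)` from `{v : v 0 = i}` onto the closed walks from `i`
  refine Finset.sum_nbij' (fun v => Fin.snoc v (v ⟨0, hd⟩)) (fun w => fun t => w t.castSucc)
    ?_ ?_ ?_ ?_ ?_
  · intro v hv
    rw [Finset.mem_filter] at hv
    simp only [prefixWalks, Finset.mem_filter, Finset.mem_univ, true_and]
    refine ⟨⟨?_, fun s hs => ?_⟩, ?_⟩
    · exact (Fin.snoc_castSucc (α := fun _ => Fin N) (v ⟨0, hd⟩) v ⟨0, hd⟩).trans hv.2
    · exact absurd s.2 (by omega)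
    · exact (Fin.snoc_last (α := fun _ => Fin N) (v ⟨0, hd⟩) v).trans hv.2
  · intro w hw
    simp only [prefixWalks, Finset.mem_filter, Finset.mem_univ, true_and] at hw
    rw [Finset.mem_filter]
    exact ⟨Finset.mem_univ _, hw.1.1⟩
  · intro v _
    funext t
    exact Fin.snoc_castSucc (α := fun _ => Fin N) _ _ _
  · intro w hw
    simp only [prefixWalks, Finset.mem_filter, Finset.mem_univ, true_and] at hw
    funext s
    by_cases hs : s = Fin.last d
    · rw [hs, Fin.snoc_last]
      change w (Fin.castSucc ⟨0, hd⟩) = w (Fin.last d)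
      exact hw.1.1.trans hw.2.symm
    · obtain ⟨s', rfl⟩ := Fin.exists_castSucc_eq.2 hs
      rw [Fin.snoc_castSucc]
  · intro v _
    rw [← prod_X_closedWalk]
    unfold prefixMono
    rw [Finset.filter_true_of_mem (fun s _ => s.2)]
    refine Finset.prod_congr rfl fun t _ => ?_
    rw [stepVar_snoc hd v t]

/-- The coefficient of a closed walk in `IMM` is `1`. [cite: KumarSaraf2017, §8.3] -/
theorem coeff_immPoly_closedWalkExp (hd : 0 < d) (v : Fin d → Fin N) :
    coeff (closedWalkExp v) (immPoly N d K) = 1 := by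
  classical
  haveI : NeZero d := ⟨hd.ne'⟩
  rw [immPoly_eq_sum_closedWalks N d K hd, coeff_sum]
  simp only [coeff_monomial]
  rw [Finset.sum_eq_single v]
  · rw [if_pos rfl]
  · intro w _ hw
    rw [if_neg (fun h => hw (closedWalkExp_injective h))]
  · intro h; exact absurd (Finset.mem_univ v) h

/-- Off the closed walks, the coefficients of `IMM` vanish. [cite: KumarSaraf2017, §8.3] -/
theorem coeff_immPoly_eq_zero (hd : 0 < d) {e : (Fin d × Fin N × Fin N) →₀ ℕ}
    (he : ∀ v : Fin d → Fin N, e ≠ closedWalkExp v) : coeff e (immPoly N d K) = 0 := by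
  classical
  rw [immPoly_eq_sum_closedWalks N d K hd, coeff_sum]
  refine Finset.sum_eq_zero fun v _ => ?_
  rw [coeff_monomial, if_neg (fun h => he v h.symm)]

/-- **The support of `IMM` is the set of closed walks** (over a nontrivial coefficient ring).
[cite: KumarSaraf2017, §8.3] -/
theorem mem_support_immPoly [Nontrivial K] (hd : 0 < d) {e : (Fin d × Fin N × Fin N) →₀ ℕ} :
    e ∈ (immPoly N d K).support ↔ ∃ v : Fin d → Fin N, e = closedWalkExp v := by
  rw [mem_support_iff]
  constructor
  · intro h
    by_contra hne
    push Not at hne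
    exact h (coeff_immPoly_eq_zero hd hne)
  · rintro ⟨v, rfl⟩
    rw [coeff_immPoly_closedWalkExp hd]
    exact one_ne_zero

/-- **`IMM` is multilinear**: every monomial of `IMM` has all exponents `≤ 1`.
[cite: KumarSaraf2017, §8.3] -/
theorem le_one_of_mem_support_immPoly (hd : 0 < d) {e : (Fin d × Fin N × Fin N) →₀ ℕ}
    (he : e ∈ (immPoly N d K).support) (x : Fin d × Fin N × Fin N) : e x ≤ 1 := by
  classical
  haveI : NeZero d := ⟨hd.ne'⟩
  by_cases hex : ∃ v : Fin d → Fin N, e = closedWalkExp v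
  · obtain ⟨v, rfl⟩ := hex
    exact closedWalkExp_le_one v x
  · push Not at hex
    exact absurd (coeff_immPoly_eq_zero (K := K) hd hex) (mem_support_iff.1 he)

end IMMWalk

end Literature.Computability.AlgebraicComplexity

end
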